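import Summits.CriticalPhenomena.Ising3DConformalLimit.Theorems.HyperoctahedralRPLimitRotationInvariantNineMirrorRP
import HarnessLib

/-!
# Stub `stub_nineMirrorRP` (STUB 1) of line `null-laplacian-edge-gaussianity` for crux
# `GaussianScaleMixture.RotationUpgradeFromTwoPoint` (item stmt-CriticalPhenomena-8367)

THEOREM-ONLY file.  Nine-mirror Osterwalder–Schrader positivity of ALL orders for every normalised,
translation-invariant pointwise scaling limit `S` of `criticalCorr 3` (`ρ > 0` on `(0,1]`): for each of the
nine lattice normals `n ∈ {eᵢ, eᵢ + eⱼ, eᵢ - eⱼ}`, every finite family of clusters `A a` in the open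
half-space `{0 < ⟪x, n⟫}` and reals `c a`, the Gram sum `∑_{a,b} c_a c_b S(θ_n A_a ⊔ A_b)` is `≥ 0`.

Proof: this is the registered stub VERBATIM (hypotheses (H1), (H2), (H3), (H5) only; the normal in the
explicit `∃ i j` form), obtained from the landed transfer lemma
`QuarterTurnLiouville.sum_sum_mul_limit_nonneg_of_latticeMirrorRP`
(`Theorems/HyperoctahedralRPLimitRotationInvariantNineMirrorRP.lean`, line `quarter-turn-liouville` of the
sibling crux stmt-1980) exactly as its `stub_nineMirrorRP` does, case by case over the three kinds of
normals: lattice site-mirror reflection positivity of `criticalCorr 3`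
(`HyperoctahedralRPNineMirror.criticalCorrNineMirrorRP_proof`, FILS 1978 §3), the half-mesh shift
intertwining `latticeApprox ∘ θ_n = θ_lattice ∘ latticeApprox` off countably many meshes, eventual
positivity of the lattice level, and passage to the limit along moving configurations.
References: J. Fröhlich, R. Israel, E. H. Lieb, B. Simon, Comm. Math. Phys. 62 (1978) §3 Thm 3.1;
J. Glimm, A. Jaffe, *Quantum Physics* (1987) §6.1.
-/

noncomputable section

open scoped BigOperators
open Filter Topology
open Literature.Probability.LatticeModels
open Literature.MathematicalPhysics.QuantumFieldTheory
open Summit.CriticalPhenomena.Ising3DConformalLimit.Cruxes.LimitRotationInvariant.QuarterTurnLiouville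
  (sum_sum_mul_limit_nonneg_of_latticeMirrorRP latticeApprox_refl_single eventually_level_single
    latticeApprox_refl_single_add_single eventually_level_single_add_single
    latticeApprox_refl_single_sub_single eventually_level_single_sub_single)

namespace Summit.CriticalPhenomena.Ising3DConformalLimit.Cruxes.RotationUpgradeFromTwoPoint.NullLaplacianEdgeGaussianity

/-- **STUB 1 · `stub_nineMirrorRP`** (registered signature, verbatim).  Nine-mirror reflection positivity
of all orders of a normalised, translation-invariant pointwise scaling limit of `criticalCorr 3`, for the
nine lattice normals `eᵢ`, `eᵢ + eⱼ`, `eᵢ - eⱼ` (`i ≠ j`), clusters in the open half-space `⟪·, n⟫ > 0`.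
[cite: FrohlichEtAl1978, §3 Thm 3.1] -/
theorem stub_nineMirrorRP :
    ∀ (ρ : ℝ → ℝ) (S : CorrFamily 3), (∀ δ ∈ Set.Ioc (0:ℝ) 1, 0 < ρ δ) →
      HasPointwiseScalingLimit (criticalCorr 3) ρ S →
      (∀ n z, z ∉ NonCoincident 3 n → S n z = 0) → IsTranslationInvariant S →
      ∀ n : EuclideanSpace ℝ (Fin 3),
        (∃ i j : Fin 3, i ≠ j ∧ (n = EuclideanSpace.single i 1 ∨
          n = EuclideanSpace.single i 1 + EuclideanSpace.single j 1 ∨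
          n = EuclideanSpace.single i 1 - EuclideanSpace.single j 1)) →
        ∀ (k : ℕ) (m : Fin k → ℕ) (A : (a : Fin k) → Fin (m a) → EuclideanSpace ℝ (Fin 3))
          (c : Fin k → ℝ), (∀ a i, 0 < inner ℝ (A a i) n) →
          0 ≤ ∑ a, ∑ b, c a * c b *
            S (m a + m b) (Fin.append (fun i => ((ℝ ∙ n)ᗮ).reflection (A a i)) (A b)) := by
  intro ρ S _ hlim hnorm htr n hn k m A c hA
  have hθinj : Function.Injective (fun p : EuclideanSpace ℝ (Fin 3) => ((ℝ ∙ n)ᗮ).reflection p) :=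
    ((ℝ ∙ n)ᗮ).reflection.injective
  have hθn : ∀ p, inner ℝ (((ℝ ∙ n)ᗮ).reflection p) n = -inner ℝ p n :=
    fun p => inner_mirrorReflection_normal n p
  obtain ⟨i, j, hij, rfl | rfl | rfl⟩ := hn
  · -- axis mirror `e_i`: site mirror `y ↦ update y i (-y_i)`, level `y_i`, shift direction `e_i`
    exact sum_sum_mul_limit_nonneg_of_latticeMirrorRP hlim hnorm htr _ _ hθinj hθn
      (fun y : Site 3 => Function.update y i (-y i)) (fun y : Site 3 => y i)
      (EuclideanSpace.single i (1 : ℝ))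
      (HyperoctahedralRPNineMirror.criticalCorrNineMirrorRP_proof
        (fun y : Site 3 => Function.update y i (-y i)) (fun y : Site 3 => y i)
        ⟨i, j, hij, Or.inl ⟨rfl, rfl⟩⟩)
      (fun p δ hδ hp => latticeApprox_refl_single i p hδ hp)
      (fun p hp => eventually_level_single i hp) k m A c hA
  · -- anti-diagonal mirror `e_i + e_j`: `y_i ↦ -y_j, y_j ↦ -y_i`, level `y_i + y_j`, shift `e_i + e_j`
    exact sum_sum_mul_limit_nonneg_of_latticeMirrorRP hlim hnorm htr _ _ hθinj hθn
      (fun y : Site 3 => Function.update (Function.update y i (-y j)) j (-y i))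
      (fun y : Site 3 => y i + y j) (EuclideanSpace.single i (1 : ℝ) + EuclideanSpace.single j 1)
      (HyperoctahedralRPNineMirror.criticalCorrNineMirrorRP_proof
        (fun y : Site 3 => Function.update (Function.update y i (-y j)) j (-y i))
        (fun y : Site 3 => y i + y j) ⟨i, j, hij, Or.inr (Or.inr ⟨rfl, rfl⟩)⟩)
      (fun p δ hδ hp => latticeApprox_refl_single_add_single hij p hδ hp)
      (fun p hp => eventually_level_single_add_single hij hp) k m A c hA
  · -- diagonal mirror `e_i - e_j`: swap of `y_i, y_j`, level `y_i - y_j`, no shift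
    exact sum_sum_mul_limit_nonneg_of_latticeMirrorRP hlim hnorm htr _ _ hθinj hθn
      (fun y : Site 3 => y ∘ Equiv.swap i j) (fun y : Site 3 => y i - y j)
      (0 : EuclideanSpace ℝ (Fin 3))
      (HyperoctahedralRPNineMirror.criticalCorrNineMirrorRP_proof
        (fun y : Site 3 => y ∘ Equiv.swap i j) (fun y : Site 3 => y i - y j)
        ⟨i, j, hij, Or.inr (Or.inl ⟨rfl, rfl⟩)⟩)
      (fun p δ _ _ => latticeApprox_refl_single_sub_single hij p δ)
      (fun p hp => eventually_level_single_sub_single hp) k m A c hA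

end Summit.CriticalPhenomena.Ising3DConformalLimit.Cruxes.RotationUpgradeFromTwoPoint.NullLaplacianEdgeGaussianity

end
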